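import Summits.BirchSwinnertonDyer.BirchSwinnertonDyer.Theses.TameQuarticManinParity
import Literature.NumberTheory.EllipticCurves.ModularJacobianNeronLatticeCuspCriterion
import Literature.NumberTheory.EllipticCurves.ModularJacobianNeronDifferentialsManinProofs
import Literature.NumberTheory.EllipticCurves.CuspFormLFunction

/-!
# Route `TameQuarticManinParity`, glue item `ALStableThreeCuspRegularOfAdjunction` (stmt-BirchSwinnertonDyer-23793):
# `MiddleCuspAverageLaw → CuspValuationByDenominatorType → FrickeBoundsCuspZero → ALStableFrickeMem → ALStableThreeCuspRegular`

LINE 49 of the ideator seat bsd-idea-3 (g14), «adjunction on the Katz–Mazur `(1,1)`-component».  This file proves ONLY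
the glue (split of AL48 `ALStableThreeCuspRegular`, route rev 85): for `h` in an Atkin–Lehner-stable sublattice `M` of the
integral cusp forms put `g := 3h`; integrality at `∞` gives `a = −1` for `g`, `ALStableFrickeMem` (W49) + `FrickeBoundsCuspZero`
(S49) give the bound `3^{2+b}` with `b = −1` at the cusp `0`, `MiddleCuspAverageLaw` (K49) gives `≤ 3⁰` at every cusp of
denominator valuation `1`, and `CuspValuationByDenominatorType` (U49) transports the bounds at `∞` and `0` to the other cusps
of denominator valuation `2` and `0`; a case split on `v₃(den γ) ∈ {0,1,2}` assembles the ČNS-regular bound.  The crux K49 and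
the supports U49/S49/W49 are NOT proved here; AL48, the rung chain above it and BSD are NOT proved.  No `sorry`.
-/

set_option autoImplicit false
-- D-0017: single-problem summit, so `Summit.BirchSwinnertonDyer.BirchSwinnertonDyer.…` repeats a namespace BY DESIGN.
set_option linter.dupNamespace false

open Literature.NumberTheory.EllipticCurves.ModularForms CongruenceSubgroup
open scoped MatrixGroups
open Summit.BirchSwinnertonDyer.BirchSwinnertonDyer.Theses.TameQuarticManinParity

namespace Summit.BirchSwinnertonDyer.BirchSwinnertonDyer.Theorems.TameQuarticManinParity.AdjunctionKM

/-- Integers have `3`-adic norm `≤ 1` under any `ι : ℚ̄₃ ≃ ℂ`. -/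
theorem norm_symm_intCast_le_one (ι : PadicAlgCl 3 ≃+* ℂ) (z : ℤ) : ‖ι.symm (z : ℂ)‖ ≤ 1 := by
  rw [map_intCast, show ((z : PadicAlgCl 3)) = (((z : ℚ_[3]) : PadicAlgCl 3)) by rfl,
    PadicAlgCl.norm_extends]
  exact Padic.norm_int_le_one z

/-- `‖ι⁻¹ 3‖ = 3⁻¹`. -/
theorem norm_symm_three (ι : PadicAlgCl 3 ≃+* ℂ) : ‖ι.symm (3 : ℂ)‖ = (3 : ℝ)⁻¹ := by
  have h3 : ι.symm (3 : ℂ) = (((3 : ℕ) : ℚ_[3]) : PadicAlgCl 3) := by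
    rw [show (3 : ℂ) = ((3 : ℕ) : ℂ) by norm_num, map_natCast]; push_cast; rfl
  rw [h3, PadicAlgCl.norm_extends]
  have := Padic.norm_p (p := 3)
  exact_mod_cast this

/-- `S` has cusp denominator `gcd(1, N) = 1`. -/
theorem cuspDenominator_S (N : ℕ) : cuspDenominator N ModularGroup.S = 1 := by
  simp [cuspDenominator, ModularGroup.S]

/-- **LINE 49 composition (kernel-checked):** the middle-cusp average law, the ČNS Lemma 5.13 uniformity,
the Fricke/cusp-0 dictionary and Fricke-stability of AL-stable lattices imply AL48 by name. -/
theorem alStableThreeCuspRegular_of_adjunction (hE : MiddleCuspAverageLaw)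
    (hU : CuspValuationByDenominatorType) (hS : FrickeBoundsCuspZero) (hW : ALStableFrickeMem) :
    ALStableThreeCuspRegular := by
  intro N _ hN M hMint hMal h hh
  -- integrality of `h` and of `w_N h`
  have hint : ∀ f ∈ M, ∀ n, ∃ z : ℤ, (z : ℂ) = cuspCoeff f n := fun f hf ↦
    mem_integralCuspForms0.mp (hMint hf)
  have hWh : frickeInvolution N 2 h ∈ M := hW N M hMal h hh
  set g : CuspForm (Gamma0 N) 2 := (3 : ℂ) • h with hg
  -- coefficients of `g = 3h` at `∞`: rational, norm ≤ 3⁻¹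
  have hgq : ∀ n : ℕ, ∃ q : ℚ, (q : ℂ) = cuspCoeff g n := fun n ↦ by
    obtain ⟨z, hz⟩ := hint h hh n
    exact ⟨3 * z, by rw [hg, cuspCoeff_const_smul, ← hz]; push_cast; ring⟩
  have hA : ∀ (ι : PadicAlgCl 3 ≃+* ℂ) (n : ℕ), ‖ι.symm (cuspCoeff g n)‖ ≤ (3 : ℝ) ^ ((-1 : ℤ) : ℝ) := by
    intro ι n
    obtain ⟨z, hz⟩ := hint h hh n
    rw [hg, cuspCoeff_const_smul, ← hz, map_mul, norm_mul, norm_symm_three]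
    calc (3 : ℝ)⁻¹ * ‖ι.symm (z : ℂ)‖ ≤ (3 : ℝ)⁻¹ * 1 := by
          gcongr; exact norm_symm_intCast_le_one ι z
      _ = (3 : ℝ) ^ ((-1 : ℤ) : ℝ) := by norm_num [Real.rpow_neg_one]
  -- coefficients of `g` at `0 = S∞`: norm ≤ 3^{2 + (-1)}
  have hB : ∀ (ι : PadicAlgCl 3 ≃+* ℂ) (n : ℕ),
      ‖ι.symm (fourierCoeffAtCusp N 2 ⇑g ModularGroup.S n)‖ ≤ (3 : ℝ) ^ ((2 : ℝ) + ((-1 : ℤ) : ℝ)) := by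
    intro ι n
    have hWg : ∀ m : ℕ, ‖ι.symm (cuspCoeff (frickeInvolution N 2 g) m)‖ ≤ (3 : ℝ)⁻¹ := by
      intro m
      obtain ⟨z, hz⟩ := hint _ hWh m
      rw [hg, map_smul, cuspCoeff_const_smul, ← hz, map_mul, norm_mul, norm_symm_three]
      calc (3 : ℝ)⁻¹ * ‖ι.symm (z : ℂ)‖ ≤ (3 : ℝ)⁻¹ * 1 := by
            gcongr; exact norm_symm_intCast_le_one ι z
        _ = (3 : ℝ)⁻¹ := mul_one _
    refine (hS N g ι _ hWg n).trans (le_of_eq ?_)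
    rw [hN]; push_cast; norm_num [Real.rpow_natCast]
  -- the average law at the middle cusps: norm ≤ 3^{1 + (-1 + -1)/2} = 1
  have hmid := hE N hN g hgq (-1) (-1) hA hB
  refine ⟨g, hgq, ?_, hg⟩
  intro γ ι n
  have hvle : padicValNat 3 (cuspDenominator N γ) ≤ 2 := hN ▸ padicValNat_cuspDenominator_le (p := 3) γ
  obtain hv | hv | hv : padicValNat 3 (cuspDenominator N γ) = 0 ∨ padicValNat 3 (cuspDenominator N γ) = 1 ∨
      padicValNat 3 (cuspDenominator N γ) = 2 := by omega
  · -- outer cusps: transfer from `S` (denominator valuation 0), bound 3 ≤ 3²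
    have hS0 : padicValNat 3 (cuspDenominator N ModularGroup.S) = padicValNat 3 (cuspDenominator N γ) := by
      rw [cuspDenominator_S, hv]; simp
    have hle := hU N g ι ModularGroup.S γ hS0 _ (hB ι) n
    refine hle.trans ?_
    rw [hN, hv, cesnaviciusNeururerSahaCuspBound_of_eq_zero_or_eq (Or.inl rfl)]
    push_cast
    exact Real.rpow_le_rpow_of_exponent_le (by norm_num) (by norm_num)
  · -- middle cusps: the average law, bound 1 ≤ 3^{1/2}
    refine (hmid γ hv ι n).trans ?_
    rw [hN, hv]
    unfold cesnaviciusNeururerSahaCuspBound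
    push_cast
    exact Real.rpow_le_rpow_of_exponent_le (by norm_num) (by norm_num)
  · -- inner cusps: transfer from `∞ = 1·∞` (denominator `N`, valuation 2), bound 3⁻¹ ≤ 1
    have h10 : padicValNat 3 (cuspDenominator N 1) = padicValNat 3 (cuspDenominator N γ) := by
      rw [cuspDenominator_one, hN, hv]
    have hA1 : ∀ m : ℕ, ‖ι.symm (fourierCoeffAtCusp N 2 ⇑g 1 m)‖ ≤ (3 : ℝ) ^ ((-1 : ℤ) : ℝ) := fun m ↦ by
      rw [fourierCoeffAtCusp_one]; exact hA ι m
    have hle := hU N g ι 1 γ h10 _ hA1 n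
    refine hle.trans ?_
    rw [hN, hv, cesnaviciusNeururerSahaCuspBound_of_eq_zero_or_eq (Or.inr rfl)]
    push_cast
    exact Real.rpow_le_rpow_of_exponent_le (by norm_num) (by norm_num)

/-- The glue item BY NAME: closes `TameQuarticManinParity.ALStableThreeCuspRegularOfAdjunction`
(stmt-BirchSwinnertonDyer-23793). -/
theorem alStableThreeCuspRegularOfAdjunction_holds :
    Summit.BirchSwinnertonDyer.BirchSwinnertonDyer.Theses.TameQuarticManinParity.ALStableThreeCuspRegularOfAdjunction :=
  alStableThreeCuspRegular_of_adjunction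

end Summit.BirchSwinnertonDyer.BirchSwinnertonDyer.Theorems.TameQuarticManinParity.AdjunctionKM
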